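/-
Copyright (c) 2026. All rights reserved.
Released under Apache 2.0 license as described in the file LICENSE.
-/
import Literature.Analysis.FunctionSpaces.RieszThorin

/-!
# Riesz–Thorin for kernel operators on finite weighted spaces: the `L^∞` corner, the duality corner,
# and the Schur-type bound `‖K‖_{p→p} ≤ R^{1−1/p} C^{1/p}` for ALL `p ∈ [1, ∞]` and arbitrary complex kernels

statement-level skeleton of published theorems with citation tags; proofs where landed; nothing here is a claim about the
Yang–Mills mass gap  (cell `lit-balaban`, Phase-2 proof seat p04 gen 4; v1.1 = this framing line added, p04 gen 8,
referee ref-2 N1 ask; no declaration changed)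

This file types, for an ARBITRARY complex (in particular signed real) kernel `K(k,i)` on finite weighted spaces
`(ι, μ)`, `(κ, ν)` (positive weights), the paragraph of the proof of [B4, Lemma 2.2] p. 583 that invokes the
Riesz–Thorin theorem:

«Now we will prove the inequality (2.17) for G_k(□). For q = p = ∞, it is a special case of (2.16) … For q = p = 1 we
get it by duality argument, i.e. using the fact that the space L^∞(□) is adjoint to L¹(□). The Riesz-Thorin Theorem
implies it for arbitrary q = p from [1, ∞]. (For Riesz-Thorin Theorem see Ref. [6].)» and, later on the same page,
«Again by the duality argument we get that the operator G_k(□) and its first order derivatives are bounded operators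
from L¹(□) to L^{p'₁}(□), p'₁⁻¹ + p₁⁻¹ = 1.»

in the reciprocal-exponent vocabulary of `Literature.Analysis.FunctionSpaces.RieszThorinDuality` (`lnorm μ s f =
‖f‖_{L^{1/s}(μ)}`, `s = 0` the sup norm) and with the complex-interpolation theorem
`Literature.Analysis.FunctionSpaces.RieszThorin.riesz_thorin` ([Grafakos2014] Thm 1.3.4) as the interpolation step:

* `kernelOp μ K` — the weighted kernel operator `(K_μ f)(k) = Σ_i μ_i K(k,i) f(i)` as a `ℂ`-linear map (plumbing def).
* `lnorm_zero_kernelOp_le` — the corner `q = p = ∞`: weighted ROW sums `Σ_i μ_i |K(k,i)| ≤ R` give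
  `‖K_μ f‖_∞ ≤ R ‖f‖_∞`.
* `dual_corner` — «by duality argument, i.e. using the fact that the space L^∞(□) is adjoint to L¹(□)», typed in
  general: a bound `‖K_μ φ‖_{L^{1/t}(ν)} ≤ M ‖φ‖_{L^{1/s}(μ)}` for all `φ` gives, for the TRANSPOSED kernel with the
  weights exchanged, `‖Kᵀ_ν g‖_{L^{1/(1−s)}(μ)} ≤ M ‖g‖_{L^{1/(1−t)}(ν)}` for all `g` (conjugate exponents
  `1/p' = 1 − 1/p`), by the attained norming functional `RieszThorinDuality.exists_norming` and Hölder
  `RieszThorinDuality.norm_sum_le_lnorm_mul_lnorm`.  (This is also the second printed use: a corner `L^{p₁} → L^∞`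
  for `Kᵀ` gives `L¹ → L^{p'₁}` for `K`.)
* `lnorm_one_kernelOp_le` — the corner `q = p = 1`: weighted COLUMN sums `Σ_k ν_k |K(k,i)| ≤ C` give
  `‖K_μ f‖_{L¹(ν)} ≤ C ‖f‖_{L¹(μ)}`, obtained exactly as printed: the `∞` corner for `Kᵀ`, then `dual_corner`.
* `schur_riesz_thorin` — «The Riesz-Thorin Theorem implies it for arbitrary q = p from [1, ∞]»:
  `‖K_μ f‖_{L^{1/t}(ν)} ≤ R^{1−t} C^{t} ‖f‖_{L^{1/t}(μ)}` for every `t ∈ [0, 1]`; `schur_riesz_thorin_exponent` is the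
  same with the usual exponent `p ≥ 1`, and `schur_riesz_thorin_counting` the counting-measure special case
  `(Σ_k |Σ_i K(k,i) f(i)|^p)^{1/p} ≤ R^{1−1/p} C^{1/p} (Σ_i |f(i)|^p)^{1/p}` with plain row/column sums.

RELATION TO THE TREE.  The B4 lineage (`Literature.MathematicalPhysics.QuantumFieldTheory.Balaban1983to89.
B4Lemma22LpStair.lpS_schur`, `B4Lemma22InterpBox.riesz_thorin_pos`) proves these bounds for NONNEGATIVE kernels acting
on nonnegative functions (Riesz convexity / the Schur test, HONEST SCOPE (1) of `B4Lemma22InterpBox`); the present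
file is the complex-interpolation statement for arbitrary kernels and complex data, with the same constants, and the
duality corner for arbitrary exponent pairs.  Finite index types with positive weights are exactly the finite boxes
`□` with `η^d`-weighted norms of [B4]; nothing here depends on the lattice structure.

HONEST SCOPE.  Finite index sets only (the setting of [B4] §2); the measure-space form is the TODO(general form) of
`Literature.Analysis.FunctionSpaces.RieszThorin`.  Kernel-checked, standard axioms; no named fact is introduced
(`kernelOp` is a definition with a body).

References: [B4] T. Bałaban, Regularity and decay of lattice Green's functions, Comm. Math. Phys. 89 (1983) 571–597,
proof of Lemma 2.2, p. 583 (bib key `Balaban1983RegularityDecay`); L. Grafakos, Classical Fourier Analysis, 3rd ed.,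
GTM 249 (2014), Thm 1.3.4 pp. 37–39 and Example 1.3.6 p. 39 (bib key `Grafakos2014`).
-/

open Finset
open scoped BigOperators ComplexConjugate

namespace Literature.Analysis.FunctionSpaces.RieszThorin

variable {ι : Type*} [Fintype ι] {κ : Type*} [Fintype κ]

/-! ## The weighted kernel operator -/

/-- the weighted kernel operator `(K_μ f)(k) = Σ_i μ_i K(k,i) f(i)` of a kernel `K : κ → ι → ℂ` on the finite weighted
space `(ι, μ)` — the operators «G_k(□), ∂^η_μ G_k(□), G_k(□)∂^{η*}_μ» of [B4] Lemma 2.2 are of this form on the finite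
box `□` with weights `η^d` (plumbing definition for the statements below).
[cite: Balaban1983RegularityDecay, proof of Lemma 2.2 p.583] -/
def kernelOp (μ : ι → ℝ) (K : κ → ι → ℂ) : (ι → ℂ) →ₗ[ℂ] (κ → ℂ) where
  toFun f k := ∑ i, (μ i : ℂ) * K k i * f i
  map_add' f g := by
    ext k
    simp only [Pi.add_apply, mul_add, sum_add_distrib]
  map_smul' c f := by
    ext k
    simp only [Pi.smul_apply, smul_eq_mul, RingHom.id_apply, mul_sum]
    exact sum_congr rfl fun i _ => by ring

omit [Fintype κ] in
/-- unfolding `kernelOp`. [cite: Balaban1983RegularityDecay, proof of Lemma 2.2 p.583] -/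
@[simp] theorem kernelOp_apply (μ : ι → ℝ) (K : κ → ι → ℂ) (f : ι → ℂ) (k : κ) :
    kernelOp μ K f k = ∑ i, (μ i : ℂ) * K k i * f i := rfl

omit [Fintype κ] in
/-- transposing twice returns the kernel operator (eta). [cite: Balaban1983RegularityDecay, proof of Lemma 2.2 p.583] -/
theorem kernelOp_transpose_transpose (μ : ι → ℝ) (K : κ → ι → ℂ) :
    kernelOp μ (fun k i => (fun i' k' => K k' i') i k) = kernelOp μ K := rfl

/-! ## The corner `q = p = ∞`: row sums -/

/-- **THE `L^∞ → L^∞` CORNER** («For q = p = ∞ …»): if the weighted row sums satisfy `Σ_i μ_i |K(k,i)| ≤ R` for every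
`k`, then `‖K_μ f‖_∞ ≤ R ‖f‖_∞`. [cite: Balaban1983RegularityDecay, proof of Lemma 2.2 p.583] -/
theorem lnorm_zero_kernelOp_le {μ : ι → ℝ} (hμ : ∀ i, 0 ≤ μ i) (ν : κ → ℝ) {K : κ → ι → ℂ} {R : ℝ} (hR : 0 ≤ R)
    (hrow : ∀ k, ∑ i, μ i * ‖K k i‖ ≤ R) (f : ι → ℂ) :
    lnorm ν 0 (kernelOp μ K f) ≤ R * lnorm μ 0 f := by
  rw [lnorm_zero_exp, lnorm_zero_exp]
  refine (pi_norm_le_iff_of_nonneg (mul_nonneg hR (norm_nonneg _))).2 fun k => ?_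
  rw [kernelOp_apply]
  calc ‖∑ i, (μ i : ℂ) * K k i * f i‖ ≤ ∑ i, ‖(μ i : ℂ) * K k i * f i‖ := norm_sum_le _ _
    _ = ∑ i, μ i * ‖K k i‖ * ‖f i‖ := by
        refine sum_congr rfl fun i _ => ?_
        rw [norm_mul, norm_mul, Complex.norm_real, Real.norm_of_nonneg (hμ i)]
    _ ≤ ∑ i, μ i * ‖K k i‖ * ‖f‖ := sum_le_sum fun i _ =>
        mul_le_mul_of_nonneg_left (norm_le_pi_norm f i) (mul_nonneg (hμ i) (norm_nonneg _))
    _ = (∑ i, μ i * ‖K k i‖) * ‖f‖ := by rw [sum_mul]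
    _ ≤ R * ‖f‖ := mul_le_mul_of_nonneg_right (hrow k) (norm_nonneg _)

/-! ## The duality corner -/

/-- exchanging the order of summation in the pairing: `Σ_i μ_i (Kᵀ_ν g)(i) φ(i) = Σ_k ν_k (K_μ φ)(k) g(k)` — the
"transpose identity" behind the duality argument. [cite: Balaban1983RegularityDecay, proof of Lemma 2.2 p.583] -/
theorem pairing_transpose (μ : ι → ℝ) (ν : κ → ℝ) (K : κ → ι → ℂ) (φ : ι → ℂ) (g : κ → ℂ) :
    ∑ i, (μ i : ℂ) * (kernelOp ν (fun i k => K k i) g i * φ i) = ∑ k, (ν k : ℂ) * (kernelOp μ K φ k * g k) := by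
  simp only [kernelOp_apply, sum_mul, mul_sum]
  rw [sum_comm]
  exact sum_congr rfl fun k _ => sum_congr rfl fun i _ => by ring

section Dual

variable [DecidableEq ι] [DecidableEq κ] {μ : ι → ℝ} {ν : κ → ℝ}

omit [DecidableEq κ] in
/-- **THE DUALITY CORNER** («For q = p = 1 we get it by duality argument, i.e. using the fact that the space L^∞(□)
is adjoint to L¹(□)»; «Again by the duality argument we get that the operator G_k(□) and its first order derivatives
are bounded operators from L¹(□) to L^{p'₁}(□), p'₁⁻¹ + p₁⁻¹ = 1»), typed for an arbitrary kernel and an arbitrary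
pair of exponents: if `‖K_μ φ‖_{L^{1/t}(ν)} ≤ M ‖φ‖_{L^{1/s}(μ)}` for all `φ` (`s, t ∈ [0,1]`), then the transposed
kernel with exchanged weights satisfies `‖Kᵀ_ν g‖_{L^{1/(1−s)}(μ)} ≤ M ‖g‖_{L^{1/(1−t)}(ν)}` for all `g` — i.e.
`‖Kᵀ‖_{q'→p'} ≤ ‖K‖_{p→q}`.  Proof: norm `Kᵀ_ν g` by the attained functional `φ` with `‖φ‖_{1/s} ≤ 1`
(`exists_norming`), exchange the sums (`pairing_transpose`), Hölder (`norm_sum_le_lnorm_mul_lnorm`) and the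
hypothesis. [cite: Balaban1983RegularityDecay, proof of Lemma 2.2 p.583] -/
theorem dual_corner (hμ : ∀ i, 0 < μ i) (hν : ∀ k, 0 < ν k) {K : κ → ι → ℂ} {s t M : ℝ}
    (hs0 : 0 ≤ s) (hs1 : s ≤ 1) (ht0 : 0 ≤ t) (ht1 : t ≤ 1) (hM : 0 ≤ M)
    (h : ∀ φ, lnorm ν t (kernelOp μ K φ) ≤ M * lnorm μ s φ) (g : κ → ℂ) :
    lnorm μ (1 - s) (kernelOp ν (fun i k => K k i) g) ≤ M * lnorm ν (1 - t) g := by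
  obtain ⟨φ, hφ1, hφeq⟩ :=
    exists_norming hμ (t := 1 - s) (by linarith) (by linarith) (kernelOp ν (fun i k => K k i) g)
  rw [sub_sub_cancel] at hφ1
  have hre : ((lnorm μ (1 - s) (kernelOp ν (fun i k => K k i) g) : ℝ) : ℂ) =
      ∑ k, (ν k : ℂ) * (kernelOp μ K φ k * g k) := by
    rw [← hφeq, pairing_transpose]
  have key : lnorm μ (1 - s) (kernelOp ν (fun i k => K k i) g) ≤ lnorm ν t (kernelOp μ K φ) * lnorm ν (1 - t) g := by
    have H := norm_sum_le_lnorm_mul_lnorm hν ht0 ht1 (kernelOp μ K φ) g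
    rwa [← hre, Complex.norm_real, Real.norm_of_nonneg (lnorm_nonneg (fun i => (hμ i).le) _ _)] at H
  have hνle : ∀ k, 0 ≤ ν k := fun k => (hν k).le
  calc lnorm μ (1 - s) (kernelOp ν (fun i k => K k i) g)
      ≤ lnorm ν t (kernelOp μ K φ) * lnorm ν (1 - t) g := key
    _ ≤ M * lnorm μ s φ * lnorm ν (1 - t) g := mul_le_mul_of_nonneg_right (h φ) (lnorm_nonneg hνle _ _)
    _ ≤ M * 1 * lnorm ν (1 - t) g :=
        mul_le_mul_of_nonneg_right (mul_le_mul_of_nonneg_left hφ1 hM) (lnorm_nonneg hνle _ _)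
    _ = M * lnorm ν (1 - t) g := by rw [mul_one]

/-! ## The corner `q = p = 1`: column sums, by duality -/

omit [DecidableEq ι] in
/-- **THE `L¹ → L¹` CORNER, BY DUALITY** («For q = p = 1 we get it by duality argument»): if the weighted column sums
satisfy `Σ_k ν_k |K(k,i)| ≤ C` for every `i`, then `‖K_μ f‖_{L¹(ν)} ≤ C ‖f‖_{L¹(μ)}` — the column sums of `K` are
the row sums of `Kᵀ`, so `lnorm_zero_kernelOp_le` bounds `Kᵀ_ν` on `L^∞` and `dual_corner` transposes back.
[cite: Balaban1983RegularityDecay, proof of Lemma 2.2 p.583] -/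
theorem lnorm_one_kernelOp_le (hμ : ∀ i, 0 < μ i) (hν : ∀ k, 0 < ν k) {K : κ → ι → ℂ} {C : ℝ} (hC : 0 ≤ C)
    (hcol : ∀ i, ∑ k, ν k * ‖K k i‖ ≤ C) (f : ι → ℂ) :
    lnorm ν 1 (kernelOp μ K f) ≤ C * lnorm μ 1 f := by
  have hT : ∀ g : κ → ℂ, lnorm μ 0 (kernelOp ν (fun i k => K k i) g) ≤ C * lnorm ν 0 g :=
    lnorm_zero_kernelOp_le (fun k => (hν k).le) μ hC hcol
  have H := dual_corner hν hμ (K := fun i k => K k i) le_rfl zero_le_one le_rfl zero_le_one hC hT f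
  rwa [sub_zero, kernelOp_transpose_transpose] at H

/-! ## «The Riesz-Thorin Theorem implies it for arbitrary q = p from [1, ∞]» -/

/-- **SCHUR-TYPE BOUND FOR ALL `p ∈ [1, ∞]` BY RIESZ–THORIN** (reciprocal-exponent form): weighted row sums `≤ R` and
weighted column sums `≤ C` give `‖K_μ f‖_{L^{1/t}(ν)} ≤ R^{1−t} C^{t} ‖f‖_{L^{1/t}(μ)}` for every `t ∈ [0, 1]` — the
two corners `lnorm_zero_kernelOp_le` (`t = 0`), `lnorm_one_kernelOp_le` (`t = 1`) interpolated by `riesz_thorin`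
([Grafakos2014] Thm 1.3.4) at `θ = t`. [cite: Balaban1983RegularityDecay, proof of Lemma 2.2 p.583] -/
theorem schur_riesz_thorin (hμ : ∀ i, 0 < μ i) (hν : ∀ k, 0 < ν k) {K : κ → ι → ℂ} {R C : ℝ} (hR : 0 ≤ R)
    (hC : 0 ≤ C) (hrow : ∀ k, ∑ i, μ i * ‖K k i‖ ≤ R) (hcol : ∀ i, ∑ k, ν k * ‖K k i‖ ≤ C)
    {t : ℝ} (ht0 : 0 ≤ t) (ht1 : t ≤ 1) (f : ι → ℂ) :
    lnorm ν t (kernelOp μ K f) ≤ R ^ (1 - t) * C ^ t * lnorm μ t f := by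
  have H := riesz_thorin hμ hν (kernelOp μ K) (s₀ := 0) (s₁ := 1) (t₀ := 0) (t₁ := 1) (θ := t)
    le_rfl zero_le_one le_rfl zero_le_one zero_le_one le_rfl ht0 ht1 hR hC
    (lnorm_zero_kernelOp_le (fun i => (hμ i).le) ν hR hrow) (lnorm_one_kernelOp_le hμ hν hC hcol) f
  simpa only [mul_zero, zero_add, mul_one] using H

/-- **SCHUR-TYPE BOUND, USUAL EXPONENT**: for `1 ≤ p` (real),
`(Σ_k ν_k |(K_μ f)(k)|^p)^{1/p} ≤ R^{1−1/p} C^{1/p} (Σ_i μ_i |f(i)|^p)^{1/p}` (`schur_riesz_thorin` at `t = 1/p` and the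
dictionary `lnorm_inv`). [cite: Balaban1983RegularityDecay, proof of Lemma 2.2 p.583] -/
theorem schur_riesz_thorin_exponent (hμ : ∀ i, 0 < μ i) (hν : ∀ k, 0 < ν k) {K : κ → ι → ℂ} {R C : ℝ} (hR : 0 ≤ R)
    (hC : 0 ≤ C) (hrow : ∀ k, ∑ i, μ i * ‖K k i‖ ≤ R) (hcol : ∀ i, ∑ k, ν k * ‖K k i‖ ≤ C)
    {p : ℝ} (hp : 1 ≤ p) (f : ι → ℂ) :
    (∑ k, ν k * ‖kernelOp μ K f k‖ ^ p) ^ p⁻¹ ≤ R ^ (1 - p⁻¹) * C ^ p⁻¹ * (∑ i, μ i * ‖f i‖ ^ p) ^ p⁻¹ := by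
  have hp0 : 0 < p := by linarith
  have H := schur_riesz_thorin hμ hν hR hC hrow hcol (t := p⁻¹) (inv_nonneg.2 hp0.le) (inv_le_one_of_one_le₀ hp) f
  rwa [lnorm_inv ν hp0.ne', lnorm_inv μ hp0.ne'] at H

end Dual

/-- **SCHUR-TYPE BOUND, COUNTING MEASURE** (the statement free of this file's vocabulary): for a complex kernel with
plain row sums `Σ_i |K(k,i)| ≤ R` and column sums `Σ_k |K(k,i)| ≤ C` and `1 ≤ p`,
`(Σ_k |Σ_i K(k,i) f(i)|^p)^{1/p} ≤ R^{1−1/p} C^{1/p} (Σ_i |f(i)|^p)^{1/p}` — the diagonal `q = p` of (2.17) for an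
arbitrary kernel, constants as in the positive-kernel Schur test `B4Lemma22LpStair.lpS_schur` when `R = C`.
[cite: Balaban1983RegularityDecay, proof of Lemma 2.2 p.583] -/
theorem schur_riesz_thorin_counting [DecidableEq ι] [DecidableEq κ] {K : κ → ι → ℂ} {R C : ℝ} (hR : 0 ≤ R)
    (hC : 0 ≤ C) (hrow : ∀ k, ∑ i, ‖K k i‖ ≤ R) (hcol : ∀ i, ∑ k, ‖K k i‖ ≤ C) {p : ℝ} (hp : 1 ≤ p)
    (f : ι → ℂ) :
    (∑ k, ‖∑ i, K k i * f i‖ ^ p) ^ p⁻¹ ≤ R ^ (1 - p⁻¹) * C ^ p⁻¹ * (∑ i, ‖f i‖ ^ p) ^ p⁻¹ := by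
  have hμ : ∀ _i : ι, (0 : ℝ) < 1 := fun _ => one_pos
  have hν : ∀ _k : κ, (0 : ℝ) < 1 := fun _ => one_pos
  have hrow' : ∀ k, ∑ i, (1 : ℝ) * ‖K k i‖ ≤ R := fun k => by simpa only [one_mul] using hrow k
  have hcol' : ∀ i, ∑ k, (1 : ℝ) * ‖K k i‖ ≤ C := fun i => by simpa only [one_mul] using hcol i
  have H := schur_riesz_thorin_exponent (μ := fun _ => 1) (ν := fun _ => 1) hμ hν hR hC hrow' hcol' hp f
  simpa only [kernelOp_apply, Complex.ofReal_one, one_mul] using H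

end Literature.Analysis.FunctionSpaces.RieszThorin
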